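import Literature.NumberTheory.LFunctions.ConreyIwaniec2002Prop91Algebra
import Literature.NumberTheory.LFunctions.ConreyIwaniec2002MollifierMeanSquare
import HarnessLib

/-!
# Conrey–Iwaniec (2002), Proposition 9.1: the inputs of its proof assembled (p. 20 L9–38)

Conrey–Iwaniec, *Spacing of zeros of Hecke L-functions and the class number problem*, Acta Arith.
103 (2002), §9 [held text `paper:arxiv-math_0111012` p0020:L1–44]. Second file of the kernel of
line `prop81-moebius-perron` (cell landau-siegel/ls-inputs, SKELETON I6b fa4ad90e7f26b39e): the
number-theoretic side conditions of the derivation of (9.7) from (8.10) — the first display of p. 20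
(`E ≤ D^{1/2}(Σ|M|²)^{1/2} + (sup|x|)(Σ|B₁| + Σ|B₂|)`, `defectE_le_diag_offdiag`), the range numerics
of `T ≥ q^65`, `log T ≥ (log q)²` (`range_numerics`), `ℒ(q) ≤ ℒ(T)`, `L(1,χ)² log T ≤ ℒ(T)`,
`L(1,χ)²q ≥ 1` (`calL_numerics`), `|x(s)| ≤ 3C₃ log T` on the segment (`xQuot_segment_le`), and the
four coefficient sums `Σ|λ*|²/m`, `Σ|λ|²/n` over `[1,q⁴]` and `(q²,q⁴]` from (9.4)
`|λ|,|λ*| ≤ τ(·,χ) ≤ d(·)` and Corollary 6.3 (`coeff_sums_le`). Everything PROVED; the named inputs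
(Proposition 8.1, Corollary 6.3, `#{N𝔞 = n} = τ(n,χ)`) enter as HYPOTHESES here and are discharged
in `ConreyIwaniec2002Prop91Large.lean`.

## References
* [ConreyIwaniec2002] B. Conrey, H. Iwaniec, Acta Arith. 103 (2002) 259–312: §6 (6.49)–(6.50),
  §8 p. 18 and Proposition 8.1 (8.10), §9 (9.4)–(9.7).
-/

noncomputable section

open scoped NumberField
open Complex

namespace Literature.NumberTheory.LFunctions

namespace ConreyIwaniec2002

open NumberField

/-! ### Bookkeeping (proved): the binder S1 is implied by the typed Proposition 8.1 -/

/-- The restricted form S1 follows from the typed `conreyIwaniec2002_proposition81` (`2 ≤ q^65`).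
[cite: ConreyIwaniec2002, Proposition 8.1 (8.10)] -/
theorem prop81_large_of_proposition81 (h : conreyIwaniec2002_proposition81) :
    ∃ C : ℝ, 0 < C ∧
    ∀ (q : ℕ) [NeZero q], 4 < q → Odd q → ∀ χ : DirichletCharacter ℂ q,
      χ.IsPrimitive → χ.IsQuadratic → χ.Odd →
        ∀ (K : Type) [Field K] [NumberField K],
          Module.finrank ℚ K = 2 → NumberField.discr K = -(q : ℤ) →
            ∀ (ψ : ClassGroup (𝓞 K) →* ℂˣ) (T : ℝ) (S : Finset ℝ) (t' : ℝ → ℝ),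
              (q : ℝ) ^ (65 : ℕ) ≤ T → Real.exp (Real.log q ^ (2 : ℕ)) ≤ T → IsDyadicPointSet S T →
                defectD K ψ q S t' ≤
                  C * (T * Real.log q ^ (7 : ℕ) + T * calL χ T * Real.log T ^ (4 : ℕ)) := by
  obtain ⟨C, hC, hP⟩ := h
  refine ⟨C, hC, fun q _ hq hodd χ hprim hquad hoddχ K _ _ h2 hdisc ψ T S t' hT _ hS => ?_⟩
  have hq5 : (5 : ℝ) ≤ q := by exact_mod_cast hq
  have hq65 : (2 : ℝ) ≤ (q : ℝ) ^ (65 : ℕ) :=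
    calc (2 : ℝ) ≤ q := by linarith
      _ = (q : ℝ) ^ 1 := (pow_one _).symm
      _ ≤ (q : ℝ) ^ (65 : ℕ) := pow_le_pow_right₀ (by linarith) (by norm_num)
  exact hP q hq hodd χ hprim hquad hoddχ K h2 hdisc ψ T S t' (hq65.trans hT) hS


/-- **Coefficient sums, I**: `Σ_{n∈[a,b]} |c(n)|²/n ≤ Σ_{n∈[a,b]} |d(n)|²/n` from `|c(n)| ≤ |d(n)|`
termwise (`n ≥ 1`). [folklore] -/
private theorem sum_norm_sq_div_le_of_le {c d : ℕ → ℂ} {a b : ℕ}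
    (h : ∀ n, n ≠ 0 → ‖c n‖ ≤ ‖d n‖) (ha : 1 ≤ a) :
    ∑ n ∈ Finset.Icc a b, ‖c n‖ ^ 2 / n ≤ ∑ n ∈ Finset.Icc a b, ‖d n‖ ^ 2 / n := by
  refine Finset.sum_le_sum fun n hn => ?_
  rw [Finset.mem_Icc] at hn
  have hn0 : n ≠ 0 := by omega
  exact div_le_div_of_nonneg_right (pow_le_pow_left₀ (norm_nonneg _) (h n hn0) 2) (Nat.cast_nonneg n)

/-! ### Kernel composition, step 3: `E ≤ D^{1/2}(Σ|M|²)^{1/2} + (sup|x|)·Σ(|B₁|+|B₂|)` -/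

/-- **The first display of p. 20** for the sum `E(T)`: with `M(s)N(s) − 1 = B₁(s) + B₂(s)` at every
point and `|x(s)| ≤ X` on the segment,
`E ≤ D^{1/2}(Σ_s|M(s)|²)^{1/2} + X·(Σ_s|B₁(s)| + Σ_s|B₂(s)|)`.
[cite: ConreyIwaniec2002, §9 p. 20 L9–12] -/
theorem defectE_le_diag_offdiag (K : Type) [Field K] [NumberField K]
    (ψ : ClassGroup (𝓞 K) →* ℂˣ) (q : ℕ) (S : Finset ℝ) (t' : ℝ → ℝ) (X : ℝ)
    (hMN : ∀ t : ℝ,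
      shortInvSum K ψ q (1 / 2 + t * I) * shortLSum K ψ q (1 / 2 + t * I) - 1 =
        (∑ m ∈ Finset.Icc (q ^ 2 + 1) (q ^ 4), ∑ n ∈ Finset.Icc 1 (q ^ 4),
            if q ^ 4 < m * n then
              twistMoebius K (classGroupCharIdealHom ψ) m * (m : ℂ) ^ (-(1 / 2 + t * I)) *
                (twistCount K (classGroupCharIdealHom ψ) n * (n : ℂ) ^ (-(1 / 2 + t * I)))
            else 0) +
        (∑ m ∈ Finset.Icc 1 (q ^ 2), ∑ n ∈ Finset.Icc (q ^ 2 + 1) (q ^ 4),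
            if q ^ 4 < m * n then
              twistMoebius K (classGroupCharIdealHom ψ) m * (m : ℂ) ^ (-(1 / 2 + t * I)) *
                (twistCount K (classGroupCharIdealHom ψ) n * (n : ℂ) ^ (-(1 / 2 + t * I)))
            else 0))
    (hx : ∀ t ∈ S, ‖xQuot q (1 / 2 + t * I) (1 / 2 + t' t * I)‖ ≤ X) :
    defectE K ψ q S t' ≤
      Real.sqrt (defectD K ψ q S t') *
          Real.sqrt (∑ t ∈ S, ‖shortInvSum K ψ q (1 / 2 + t * I)‖ ^ 2) +
        X * (∑ t ∈ S, ‖(∑ m ∈ Finset.Icc (q ^ 2 + 1) (q ^ 4), ∑ n ∈ Finset.Icc 1 (q ^ 4),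
            if q ^ 4 < m * n then
              twistMoebius K (classGroupCharIdealHom ψ) m * (m : ℂ) ^ (-(1 / 2 + t * I)) *
                (twistCount K (classGroupCharIdealHom ψ) n * (n : ℂ) ^ (-(1 / 2 + t * I)))
            else 0)‖ +
          ∑ t ∈ S, ‖(∑ m ∈ Finset.Icc 1 (q ^ 2), ∑ n ∈ Finset.Icc (q ^ 2 + 1) (q ^ 4),
            if q ^ 4 < m * n then
              twistMoebius K (classGroupCharIdealHom ψ) m * (m : ℂ) ^ (-(1 / 2 + t * I)) *
                (twistCount K (classGroupCharIdealHom ψ) n * (n : ℂ) ^ (-(1 / 2 + t * I)))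
            else 0)‖) := by
  unfold defectE defectD
  exact sum_le_sqrt_mul_sqrt_add (S := S)
    (e := fun t => ‖dividedDifference (classGroupLFunction K ψ) (1 / 2 + t * I) (1 / 2 + t' t * I) *
        starRingEnd ℂ (shortInvSum K ψ q (1 / 2 + t * I)) -
      xQuot q (1 / 2 + t * I) (1 / 2 + t' t * I)‖)
    (a := fun t => ‖dividedDifference (classGroupLFunction K ψ) (1 / 2 + t * I) (1 / 2 + t' t * I) -
      xQuot q (1 / 2 + t * I) (1 / 2 + t' t * I) *
        starRingEnd ℂ (shortLSum K ψ q (1 / 2 + t * I))‖)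
    (b := fun t => ‖shortInvSum K ψ q (1 / 2 + t * I)‖)
    (g₁ := fun t => ‖(∑ m ∈ Finset.Icc (q ^ 2 + 1) (q ^ 4), ∑ n ∈ Finset.Icc 1 (q ^ 4),
            if q ^ 4 < m * n then
              twistMoebius K (classGroupCharIdealHom ψ) m * (m : ℂ) ^ (-(1 / 2 + t * I)) *
                (twistCount K (classGroupCharIdealHom ψ) n * (n : ℂ) ^ (-(1 / 2 + t * I)))
            else 0)‖)
    (g₂ := fun t => ‖(∑ m ∈ Finset.Icc 1 (q ^ 2), ∑ n ∈ Finset.Icc (q ^ 2 + 1) (q ^ 4),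
            if q ^ 4 < m * n then
              twistMoebius K (classGroupCharIdealHom ψ) m * (m : ℂ) ^ (-(1 / 2 + t * I)) *
                (twistCount K (classGroupCharIdealHom ψ) n * (n : ℂ) ^ (-(1 / 2 + t * I)))
            else 0)‖)
    (X := X)
    (fun t ht => pointwise_E_le (hMN t) (hx t ht))
    (fun t _ => norm_nonneg _) (fun t _ => norm_nonneg _)


/-! ### Kernel composition, step 4: the numerical side conditions -/

/-- Range numerics: `q > 4`, `T ≥ q^65`, `T ≥ e^{(log q)²}` give `log q ≥ 1`, `(log q)² ≤ log T`,
`q⁴ ≤ T`, `q ≤ T`, `T > 0`, `log T ≥ 1`. [cite: ConreyIwaniec2002, §8 p. 18 (T ≥ q^65)] -/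
theorem range_numerics {q : ℕ} (hq : 4 < q) {T : ℝ} (hT : (q : ℝ) ^ (65 : ℕ) ≤ T)
    (hexpT : Real.exp (Real.log q ^ (2 : ℕ)) ≤ T) :
    1 ≤ Real.log q ∧ Real.log q ^ 2 ≤ Real.log T ∧ (q : ℝ) ^ (4 : ℕ) ≤ T ∧ (q : ℝ) ≤ T ∧
      0 < T ∧ Real.log q ≤ Real.log T ∧ 1 ≤ Real.log T := by
  have hq5 : (5 : ℝ) ≤ q := by exact_mod_cast hq
  have hq1 : (1 : ℝ) ≤ q := by linarith
  have hℓ1 : 1 ≤ Real.log q := by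
    rw [Real.le_log_iff_exp_le (by linarith)]
    exact Real.exp_one_lt_d9.le.trans (by linarith)
  have hq4T : (q : ℝ) ^ (4 : ℕ) ≤ T := le_trans (pow_le_pow_right₀ hq1 (by norm_num)) hT
  have hq_le_T : (q : ℝ) ≤ T := by
    have h := pow_le_pow_right₀ hq1 (by norm_num : 1 ≤ 65)
    rw [pow_one] at h
    exact h.trans hT
  have hT0 : 0 < T := by linarith
  have hℓLT : Real.log q ^ 2 ≤ Real.log T := by
    have h := Real.log_le_log (Real.exp_pos _) hexpT
    rwa [Real.log_exp] at h
  have hℓ_le_LT : Real.log q ≤ Real.log T := le_trans (by nlinarith) hℓLT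
  exact ⟨hℓ1, hℓLT, hq4T, hq_le_T, hT0, hℓ_le_LT, hℓ1.trans hℓ_le_LT⟩

/-- `ℒ` numerics: from `L(1,χ) ≥ π/√q` and `q ≤ T`: `L(1,χ)²q ≥ 1`, `L(1,χ)² log T ≤ ℒ(T)`,
`0 ≤ ℒ(q) ≤ ℒ(T)`. [cite: ConreyIwaniec2002, Corollary 6.3 (6.50)] -/
theorem calL_numerics {q : ℕ} [NeZero q] (hq : 4 < q) (χ : DirichletCharacter ℂ q) {T : ℝ}
    (hqT : (q : ℝ) ≤ T) (hL : Real.pi / Real.sqrt q ≤ ‖χ.LFunction 1‖) :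
    1 ≤ ‖χ.LFunction 1‖ ^ 2 * q ∧ ‖χ.LFunction 1‖ ^ 2 * Real.log T ≤ calL χ T ∧
      0 ≤ calL χ q ∧ calL χ q ≤ calL χ T := by
  have hq5 : (5 : ℝ) ≤ q := by exact_mod_cast hq
  have hq1 : (1 : ℝ) ≤ q := by linarith
  have hqpos : (0 : ℝ) < q := by linarith
  have hL1 : 0 ≤ ‖χ.LFunction 1‖ := norm_nonneg _
  have hd0 : 0 ≤ ‖deriv χ.LFunction 1‖ := norm_nonneg _
  refine ⟨?_, ?_, calL_nonneg χ hq1, ?_⟩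
  · have hsq : 0 < Real.sqrt q := Real.sqrt_pos.mpr hqpos
    have h' : Real.pi ≤ ‖χ.LFunction 1‖ * Real.sqrt q := by rwa [div_le_iff₀ hsq] at hL
    have hπ : (1 : ℝ) ≤ Real.pi := by linarith [Real.pi_gt_three]
    have h'' : 1 ≤ ‖χ.LFunction 1‖ * Real.sqrt q := hπ.trans h'
    calc (1 : ℝ) = 1 ^ 2 := by norm_num
      _ ≤ (‖χ.LFunction 1‖ * Real.sqrt q) ^ 2 := pow_le_pow_left₀ zero_le_one h'' 2
      _ = ‖χ.LFunction 1‖ ^ 2 * q := by rw [mul_pow, Real.sq_sqrt hqpos.le]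
  · unfold calL
    nlinarith [mul_nonneg hL1 hd0]
  · unfold calL
    have : Real.log q ≤ Real.log T := Real.log_le_log hqpos hqT
    gcongr

/-- `x(s)` on the segment: `|x(½+it)| ≤ C₃(log q + log 2T) ≤ 3C₃ log T` for `t ∈ S ⊂ (T,2T]`,
`T ≥ 2`, `log q ≤ log T`, `log T ≥ 1`. [cite: ConreyIwaniec2002, Lemma 7.5 (7.28)] -/
theorem xQuot_segment_le {C₃ : ℝ} (hC₃ : 0 < C₃)
    (hx : ∀ q : ℕ, 4 < q → ∀ t t' : ℝ, 2 ≤ t →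
      ‖xQuot q (1 / 2 + t * I) (1 / 2 + t' * I)‖ ≤ C₃ * (Real.log q + Real.log t))
    {q : ℕ} (hq : 4 < q) {T : ℝ} (hT2 : 2 ≤ T) {S : Finset ℝ} (hS : IsDyadicPointSet S T)
    (t' : ℝ → ℝ) (hℓT : Real.log q ≤ Real.log T) (hLT1 : 1 ≤ Real.log T) :
    (∀ t ∈ S, ‖xQuot q (1 / 2 + t * I) (1 / 2 + t' t * I)‖ ≤ C₃ * (Real.log q + Real.log (2 * T))) ∧
      C₃ * (Real.log q + Real.log (2 * T)) ≤ 3 * C₃ * Real.log T := by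
  have hT0 : 0 < T := by linarith
  refine ⟨fun t ht => ?_, ?_⟩
  · obtain ⟨hTt, ht2T⟩ := hS.1 t ht
    have ht2 : (2 : ℝ) ≤ t := by linarith
    have hlog : Real.log t ≤ Real.log (2 * T) := Real.log_le_log (by linarith) ht2T
    calc _ ≤ C₃ * (Real.log q + Real.log t) := hx q hq t (t' t) ht2
      _ ≤ C₃ * (Real.log q + Real.log (2 * T)) := by gcongr
  · have h2T : Real.log (2 * T) = Real.log 2 + Real.log T := Real.log_mul (by norm_num) hT0.ne'
    have hlog2 : Real.log 2 ≤ 1 := by linarith [Real.log_two_lt_d9]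
    rw [h2T]
    nlinarith

/-- **The four coefficient sums of p. 20** (`|λ*(m)|, |λ(n)| ≤ τ(·,χ) ≤ d(·)`, (9.4)):
`Σ_{q²<m≤q⁴}|λ*(m)|²/m`, `Σ_{q²<n≤q⁴}|λ(n)|²/n ≤ C₅(8ℒ(q)log q + (q/(q²+1))^{1/2})` (Corollary 6.3 at
`X = q²+1`, `Y = q⁴`, with `ℒ(q⁴) ≤ 4ℒ(q)`, `log(Y/X) ≤ 2 log q`), and
`Σ_{n≤q⁴}|λ(n)|²/n`, `Σ_{m≤q²}|λ*(m)|²/m ≤ (1 + 4 log q)⁴` (tree `sum_card_divisors_sq_div_le`).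
[cite: ConreyIwaniec2002, §9 p. 20 L14–36 and (9.4)] -/
theorem coeff_sums_le {q : ℕ} [NeZero q] (hq : 4 < q) {χ : DirichletCharacter ℂ q}
    (K : Type) [Field K] [NumberField K] (ψ : ClassGroup (𝓞 K) →* ℂˣ)
    (hid : ∀ {n : ℕ}, n ≠ 0 → (idealNormCount K n : ℝ) = ‖divisorSumChar χ n‖)
    {C₅ : ℝ} (hC₅ : 0 < C₅)
    (h63 : ∀ X Y : ℝ, 1 ≤ X → 2 * X ≤ Y →
      ∑ n ∈ Finset.Icc ⌈X⌉₊ ⌊Y⌋₊, ‖divisorSumChar χ n‖ ^ 2 / (n : ℝ) ≤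
        C₅ * (calL χ Y * Real.log (Y / X) + Real.sqrt (q / X))) :
    (∑ m ∈ Finset.Icc (q ^ 2 + 1) (q ^ 4), ‖twistMoebius K (classGroupCharIdealHom ψ) m‖ ^ 2 / m ≤
        C₅ * (8 * calL χ q * Real.log q + Real.sqrt ((q : ℝ) / ((q ^ 2 + 1 : ℕ) : ℝ)))) ∧
    (∑ n ∈ Finset.Icc 1 (q ^ 4), ‖twistCount K (classGroupCharIdealHom ψ) n‖ ^ 2 / n ≤
        (1 + 4 * Real.log q) ^ 4) ∧
    (∑ m ∈ Finset.Icc 1 (q ^ 2), ‖twistMoebius K (classGroupCharIdealHom ψ) m‖ ^ 2 / m ≤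
        (1 + 4 * Real.log q) ^ 4) ∧
    (∑ n ∈ Finset.Icc (q ^ 2 + 1) (q ^ 4), ‖twistCount K (classGroupCharIdealHom ψ) n‖ ^ 2 / n ≤
        C₅ * (8 * calL χ q * Real.log q + Real.sqrt ((q : ℝ) / ((q ^ 2 + 1 : ℕ) : ℝ)))) ∧
    Real.sqrt ((q : ℝ) / ((q ^ 2 + 1 : ℕ) : ℝ)) ^ 2 * q ≤ 1 := by
  have hq0 : 0 < q := by omega
  have hq5 : (5 : ℝ) ≤ q := by exact_mod_cast hq
  have hq1 : (1 : ℝ) ≤ q := by linarith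
  have hqpos : (0 : ℝ) < q := by linarith
  have hℓ1 : 1 ≤ Real.log q := by
    rw [Real.le_log_iff_exp_le (by linarith)]
    exact Real.exp_one_lt_d9.le.trans (by linarith)
  have hℓ0 : 0 ≤ Real.log q := by linarith
  have hL1 : 0 ≤ ‖χ.LFunction 1‖ := norm_nonneg _
  have hd0 : 0 ≤ ‖deriv χ.LFunction 1‖ := norm_nonneg _
  have hν : ∀ I, ‖classGroupCharIdealHom ψ I‖ ≤ 1 := norm_classGroupCharIdealHom_le ψ
  have hlog4 : Real.log ((q ^ 4 : ℕ) : ℝ) = 4 * Real.log q := by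
    push_cast; rw [Real.log_pow]; push_cast; ring
  have hlog2 : Real.log ((q ^ 2 : ℕ) : ℝ) = 2 * Real.log q := by
    push_cast; rw [Real.log_pow]; push_cast; ring
  have hX : ((q ^ 2 + 1 : ℕ) : ℝ) = (q : ℝ) ^ 2 + 1 := by push_cast; ring
  have hY : ((q ^ 4 : ℕ) : ℝ) = (q : ℝ) ^ 4 := by push_cast; ring
  have hXpos : (0 : ℝ) < ((q ^ 2 + 1 : ℕ) : ℝ) := by positivity
  have hq44 : (q : ℝ) ^ 4 = (q : ℝ) ^ 2 * (q : ℝ) ^ 2 := by ring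
  have h25 : (25 : ℝ) ≤ (q : ℝ) ^ 2 := by nlinarith
  -- coefficient bounds `|λ|, |λ*| ≤ τ(·,χ) ≤ d(·)`
  have hcoefM : ∀ m, m ≠ 0 → ‖twistMoebius K (classGroupCharIdealHom ψ) m‖ ≤ ‖divisorSumChar χ m‖ :=
    fun m hm => (norm_twistMoebius_le hν m).trans (le_of_eq (hid hm))
  have hcoefN : ∀ n, n ≠ 0 → ‖twistCount K (classGroupCharIdealHom ψ) n‖ ≤ ‖divisorSumChar χ n‖ :=
    fun n hn => (norm_twistCount_le hν n).trans (le_of_eq (hid hn))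
  have hdivC : ∀ n, n ≠ 0 → ‖divisorSumChar χ n‖ ≤ ‖((n.divisors.card : ℝ) : ℂ)‖ := by
    intro n _
    rw [Complex.norm_real, Real.norm_eq_abs, abs_of_nonneg (Nat.cast_nonneg _)]
    exact norm_divisorSumChar_le χ n
  have hdivsum : ∀ N : ℕ, ∑ n ∈ Finset.Icc 1 N, ‖((n.divisors.card : ℝ) : ℂ)‖ ^ 2 / n ≤
      (1 + Real.log N) ^ 4 := by
    intro N
    have h := ZetaM4D.sum_card_divisors_sq_div_le N
    refine le_trans (le_of_eq (Finset.sum_congr rfl fun n _ => ?_)) h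
    rw [Complex.norm_real, Real.norm_eq_abs, abs_of_nonneg (Nat.cast_nonneg _)]
  -- Corollary 6.3 on `(q², q⁴]`
  have hX1 : (1 : ℝ) ≤ ((q ^ 2 + 1 : ℕ) : ℝ) := by exact_mod_cast Nat.le_add_left 1 _
  have hXY : 2 * ((q ^ 2 + 1 : ℕ) : ℝ) ≤ ((q ^ 4 : ℕ) : ℝ) := by
    rw [hX, hY, hq44]; nlinarith
  have h63' := h63 ((q ^ 2 + 1 : ℕ) : ℝ) ((q ^ 4 : ℕ) : ℝ) hX1 hXY
  rw [Nat.ceil_natCast, Nat.floor_natCast] at h63'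
  have hrq : Real.sqrt ((q : ℝ) / ((q ^ 2 + 1 : ℕ) : ℝ)) ^ 2 * q ≤ 1 := by
    rw [Real.sq_sqrt (div_nonneg hqpos.le hXpos.le), div_mul_eq_mul_div, div_le_one hXpos, hX]
    nlinarith
  have hmain63 : calL χ ((q ^ 4 : ℕ) : ℝ) * Real.log (((q ^ 4 : ℕ) : ℝ) / ((q ^ 2 + 1 : ℕ) : ℝ)) ≤
      8 * calL χ q * Real.log q := by
    have hcal : calL χ ((q ^ 4 : ℕ) : ℝ) ≤ 4 * calL χ q := by
      unfold calL
      rw [hlog4]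
      nlinarith [mul_nonneg hL1 hd0, mul_nonneg hL1 (mul_nonneg hL1 hℓ0)]
    have hYX1 : (1 : ℝ) ≤ ((q ^ 4 : ℕ) : ℝ) / ((q ^ 2 + 1 : ℕ) : ℝ) := by
      rw [le_div_iff₀ hXpos, hX, hY, hq44]; nlinarith
    have hYX : ((q ^ 4 : ℕ) : ℝ) / ((q ^ 2 + 1 : ℕ) : ℝ) ≤ (q : ℝ) ^ 2 := by
      rw [div_le_iff₀ hXpos, hX, hY, hq44]; nlinarith
    have hlog0 : 0 ≤ Real.log (((q ^ 4 : ℕ) : ℝ) / ((q ^ 2 + 1 : ℕ) : ℝ)) := Real.log_nonneg hYX1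
    have hlogYX : Real.log (((q ^ 4 : ℕ) : ℝ) / ((q ^ 2 + 1 : ℕ) : ℝ)) ≤ 2 * Real.log q := by
      calc _ ≤ Real.log ((q : ℝ) ^ 2) := Real.log_le_log (by positivity) hYX
        _ = 2 * Real.log q := by rw [Real.log_pow]; push_cast; ring
    have hcq0 : 0 ≤ calL χ q := calL_nonneg χ hq1
    calc _ ≤ (4 * calL χ q) * (2 * Real.log q) := mul_le_mul hcal hlogYX hlog0 (by positivity)
      _ = 8 * calL χ q * Real.log q := by ring
  have h63'' : ∑ n ∈ Finset.Icc (q ^ 2 + 1) (q ^ 4), ‖divisorSumChar χ n‖ ^ 2 / n ≤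
      C₅ * (8 * calL χ q * Real.log q + Real.sqrt ((q : ℝ) / ((q ^ 2 + 1 : ℕ) : ℝ))) := by
    refine h63'.trans ?_
    gcongr
  refine ⟨(sum_norm_sq_div_le_of_le hcoefM (Nat.le_add_left 1 _)).trans h63'', ?_, ?_,
    (sum_norm_sq_div_le_of_le hcoefN (Nat.le_add_left 1 _)).trans h63'', hrq⟩
  · have h := (sum_norm_sq_div_le_of_le (fun n hn => (hcoefN n hn).trans (hdivC n hn)) le_rfl).trans
      (hdivsum (q ^ 4))
    rwa [hlog4] at h
  · have h := (sum_norm_sq_div_le_of_le (fun n hn => (hcoefM n hn).trans (hdivC n hn)) le_rfl).trans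
      (hdivsum (q ^ 2))
    rw [hlog2] at h
    exact h.trans (pow_le_pow_left₀ (by positivity) (by linarith) 4)

end ConreyIwaniec2002

end Literature.NumberTheory.LFunctions

end
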